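import Summits.CriticalPhenomena.CardyFormulaZ2.Theorems.CardyUniqueLimitCardyRigidityStubPercCapacityClock
import Summits.CriticalPhenomena.CardyFormulaZ2.Theorems.CardyUniqueLimitCardyRigiditySlitCrossingFreezing
import Summits.CriticalPhenomena.CardyFormulaZ2.Theorems.CardyUniqueLimitCardyRigiditySlitCrossingEventIdentity
import HarnessLib

/-!
# Cut-1 of STUB A3b, clock side: the capacity clock off the box event, its monotonicity, the
# level step, and the frozen conditional crossing probability

Crux `Summit.CriticalPhenomena.CardyFormulaZ2.Theses.CardyUniqueLimit.CardyRigidity`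
(stmt-CriticalPhenomena-0746), line `crossing_martingale`, stub A3b `stub_slitObservableApprox`,
cut "freezing at the level step" (Camia–Newman 2007, §5).  Lattice/clock lemmas of the cut:

* `SlitCardyCut.clock_mono` — the capacity clock `CapacityClock.clock` of a describable
  configuration is non-decreasing in the depth (shorter prefixes have capacity times, and
  images of trace segments are ordered by time); `clock_le_of_hasCap` — hence all earlier
  clocks are below a capacity time of a deeper prefix;
* `SlitCardyCut.eventually_clock_box` — the clock clauses of `percCapacityClockH` with the
  clock, the bad event and the driver made EXPLICIT: for a FIXED Kemppainen–Smirnov box, a cap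
  `L` and a window `Δ > 0`, eventually in `k`, every configuration whose interface is a box
  pair pushed through `Φ_k` is describable, its driving function IS the box driver (so it
  starts at `0` and has the box modulus), and its clock starts below `Δ` and has increments
  `≤ Δ` (replay of the proof of `CapacityClock.percCapacityClockH`);
* `SlitCardyCut.exists_levelStep` — the first step at which a class predicate holds, capped:
  a bounded class stopping step;
* `SlitCardyCut.exists_frozenCrossing` — the conditional crossing probability of the fixed
  event `Q = freeCrossing X₁ X₂` frozen at a bounded class stopping step `ν`:
  `X = percSlitExpectation ν 1_Q`, strongly measurable with `|X| ≤ 1`, whose slit expectation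
  at depth `n` is `P_{1/2}(slitCrossing X₁ X₂ ω₀ (n ∧ ν))` whenever the left bank of the prefix
  of depth `n ∧ ν` has met `A` only inside `X₂` (Freezing + EventIdentity).
(buildfix 2026-08-20: comment-only re-land to re-enqueue the module build after its blocking imports were repaired; no declaration changed.)
-/

noncomputable section

open MeasureTheory Filter Set Topology Metric
open scoped NNReal ENNReal unitInterval
open UpperHalfPlane (upperHalfPlaneSet)
open Literature.Probability Literature.Probability.RandomPlanarGeometry
  Literature.Probability.LatticeModels Literature.Probability.LatticeModels.DiscreteDobrushin
open Literature.Probability.Percolation (bondInterfaceIn BondConfig bondPercolation half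
  measurable_bondInterfaceIn)
open Summit.CriticalPhenomena.CardyFormulaZ2.Cruxes.ParafermionToSLESixFamilies.CaratheodoryNetSlitUniformity
  (percSlitExpectation martingale_percSlitExpectation norm_percSlitExpectation_le)

namespace Summit.CriticalPhenomena.CardyFormulaZ2.Cruxes.CardyRigidity.CrossingMartingale

namespace SlitCardyCut

open CapacityClock

/-! ### Monotonicity of the capacity clock -/

section Mono

variable {E : DiscreteDobrushin} {D D' : DobrushinDomain}
  {φ' : ConformalEquiv upperHalfPlaneSet D'.carrier}
  (hor : ∀ ω, bondInterfaceIn D E ω =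
    CurveClass.mk ⟨polyline ((medialExploration E ω).map (medialPoint E.δ))⟩)
  (hE : E.IsZdAdmissible) (hφ' : D'.IsChordalUniformizing φ')
include hor hE hφ'

/-- **The capacity clock is non-decreasing in the depth** (describable configuration): if the
clock at depth `n` is below the cap, the prefix of depth `i ≤ n` has a capacity time, at most
that of depth `n` (`IsLoewnerDescribed.image_trace_subset_iff`).
[cite: Lawler2005, Ch. 4 §4.1] -/
theorem clock_mono (L : ℝ≥0) {i n : ℕ} (hin : i ≤ n) {ω : BondConfig (Site 2)}
    (hω : IsLoewnerDescribable φ' (bondInterfaceIn D E ω)) :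
    clock D E φ' L i ω ≤ clock D E φ' L n ω := by
  rcases lt_or_ge (clock D E φ' L n ω) L with hlt | hge
  · have hTn := hasCap_clock_of_lt hor hE hφ' L hω hlt
    have hdesc := described_of hor hω
    have hgen := hdesc.exists_eq_mk_trace.1
    have hb : D'.pt 1 ∉ range (polyline ((explorationPrefix E n ω).map (medialPoint E.δ))) := by
      intro hb
      rw [← hTn] at hb
      obtain ⟨_, ⟨u, -, rfl⟩, hu⟩ := hb
      exact MarkedDomain.boundaryExtension_ne_pt_one
        JordanDomain.exists_continuousOn_extension_holds hφ' (hgen.im_nonneg u) hu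
    have hsub : range (polyline ((explorationPrefix E i ω).map (medialPoint E.δ))) ⊆
        range (polyline ((explorationPrefix E n ω).map (medialPoint E.δ))) := by
      rw [← image_Iic_polyline_map_eq_range_prefix (medialPoint E.δ) i ω,
        ← image_Iic_polyline_map_eq_range_prefix (medialPoint E.δ) n ω]
      refine image_mono (Iic_subset_Iic.2 ?_)
      show (1 : ℝ) - (1 / 2) ^ (i + 1) ≤ 1 - (1 / 2) ^ (n + 1)
      have := pow_le_pow_of_le_one (by norm_num : (0 : ℝ) ≤ 1 / 2) (by norm_num)
        (show i + 1 ≤ n + 1 by omega)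
      linarith
    have hbi : D'.pt 1 ∉ ((⟨polyline ((medialExploration E ω).map (medialPoint E.δ))⟩ : Curve ℂ) :
        I → ℂ) '' Iic ⟨1 - (1 / 2) ^ (i + 1), one_sub_half_pow_mem_unitInterval _⟩ := by
      change D'.pt 1 ∉ polyline ((medialExploration E ω).map (medialPoint E.δ)) '' _
      rw [image_Iic_polyline_map_eq_range_prefix]
      exact fun h ↦ hb (hsub h)
    obtain ⟨Ti, hTi⟩ := hdesc.exists_image_trace_eq hφ' hbi
    have hTi' : φ'.boundaryExtension '' (Loewner.trace (drivingFunction φ' (bondInterfaceIn D E ω)) ''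
        Icc 0 Ti) = range (polyline ((explorationPrefix E i ω).map (medialPoint E.δ))) := by
      have h := hTi
      change _ = polyline ((medialExploration E ω).map (medialPoint E.δ)) '' _ at h
      rwa [image_Iic_polyline_map_eq_range_prefix] at h
    have hle : Ti ≤ clock D E φ' L n ω :=
      (hdesc.image_trace_subset_iff).1 (by rw [hTi', hTn]; exact hsub)
    rw [clock_eq_min hor hE hφ' L hω hTi']
    exact (min_le_left _ _).trans hle
  · exact (clock_le L i ω).trans hge

/-- **No capacity time at or beyond the end of the exploration**: a depth with a capacity time
is below the number of inner corners. [cite: Smirnov2001, §2] -/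
theorem lt_card_of_hasCap {n : ℕ} {ω : BondConfig (Site 2)}
    (hω : IsLoewnerDescribable φ' (bondInterfaceIn D E ω)) {T : ℝ≥0}
    (hT : φ'.boundaryExtension '' (Loewner.trace (drivingFunction φ' (bondInterfaceIn D E ω)) ''
      Icc 0 T) = range (polyline ((explorationPrefix E n ω).map (medialPoint E.δ)))) :
    n < (finite_innerCorners hE).toFinset.card := by
  by_contra hge
  push Not at hge
  rw [explorationPrefix_eq_self hE ((exitTime_le_card_innerCorners hE ω).trans
    (hge.trans (Nat.le_succ n)))] at hT
  exact image_trace_ne_range hφ' (described_of hor hω) T hT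

/-- **All earlier clocks are below a capacity time**: if the prefix of depth `n` has the capacity
time `T` below the cap `L`, then `clock L i ω ≤ T` for every `i ≤ n` (`clock_mono` with
`clock_eq_min`). [cite: Lawler2005, Ch. 4 §4.1] -/
theorem clock_le_of_hasCap (L : ℝ≥0) {i n : ℕ} (hin : i ≤ n) {ω : BondConfig (Site 2)}
    (hω : IsLoewnerDescribable φ' (bondInterfaceIn D E ω)) {T : ℝ≥0} (hTL : T < L)
    (hT : φ'.boundaryExtension '' (Loewner.trace (drivingFunction φ' (bondInterfaceIn D E ω)) ''
      Icc 0 T) = range (polyline ((explorationPrefix E n ω).map (medialPoint E.δ)))) :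
    clock D E φ' L i ω ≤ T := by
  have h := clock_mono hor hE hφ' L hin hω
  rwa [clock_eq_min hor hE hφ' L hω hT, min_eq_left hTL.le] at h

end Mono

/-! ### The clock off a fixed box event, eventually in the scale -/

/-- **The capacity clock off a fixed Kemppainen–Smirnov box.**  Along admissible meshes
`δ_k → 0` with the orientation hypothesis, approximating chordal maps `φ_k` converging on
compacts of the closed half-plane with `b_k → b`: for a fixed box (moduli `δγ, δW`, transience
profile `Tt`), a cap `L` and a window `Δ > 0`, eventually in `k`, for every configuration `ω`
whose interface is a box pair pushed through `Φ_k`: the orientation identity holds at scale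
`k`, the interface is describable through `φ_k`, its driving function is a box driver
(`∈ modulusSet {0} δW`), and the capacity clock `CapacityClock.clock … L` starts below `Δ` and
has increments `≤ Δ` at every depth below the number of inner corners (uniform non-stalling,
almost-injectivity, properness, `exists_capTime_zero`, `exists_capTime_succ`).
[cite: KemppainenSmirnov2017, §3.5 and Thm. 1.5] [cite: DuminilCopinSmirnov2012Clay, Prop. 6.7] -/
theorem eventually_clock_box {D : DobrushinDomain} {E : ℝ → DiscreteDobrushin}
    (hEf : ZdDiscretisationFamily D E) {φ : ConformalEquiv upperHalfPlaneSet D.carrier}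
    (hφ : D.IsChordalUniformizing φ) {δs : ℕ → ℝ} (hδpos : ∀ k, 0 < δs k)
    (hδ0 : Tendsto δs atTop (𝓝 0)) (hδadm : ∀ k, (E (δs k)).IsZdAdmissible)
    (hor : ∀ᶠ k in atTop, ∀ ω, bondInterfaceIn D (E (δs k)) ω =
      CurveClass.mk ⟨medialExplorationCurve (E (δs k)) ω⟩)
    {Ds : ℕ → DobrushinDomain} {φs : ∀ k, ConformalEquiv upperHalfPlaneSet (Ds k).carrier}
    (hφs : ∀ k, (Ds k).IsChordalUniformizing (φs k))
    (hU1 : ∀ R : ℝ, TendstoUniformlyOn (fun k ↦ (φs k).boundaryExtension) φ.boundaryExtension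
      atTop ({z : ℂ | 0 ≤ z.im} ∩ closedBall 0 R))
    (hb : Tendsto (fun k ↦ (Ds k).pt 1) atTop (𝓝 (D.pt 1)))
    {δγ δW : ℕ → ℝ} (hδγ : ∀ j, 0 < δγ j) (hδW : ∀ j, 0 < δW j) (Tt : ℕ → ℝ≥0)
    (L : ℝ≥0) {Δ : ℝ≥0} (hΔ : 0 < Δ) :
    ∀ᶠ k in atTop, ∀ ω : BondConfig (Site 2),
      bondInterfaceIn D (E (δs k)) ω ∈
        (fun p ↦ compactifiedClass (φs k).boundaryExtension ((Ds k).pt 1) p.1) ''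
          {p : C(ℝ≥0, ℂ) × C(ℝ≥0, ℝ) | p ∈ generatedPairs ∧
            p.1 ∈ Process.modulusSet ({0} : Set ℂ) δγ ∧
            p.2 ∈ Process.modulusSet ({0} : Set ℝ) δW ∧
            ∀ (j : ℕ) (t : ℝ≥0), Tt j ≤ t → (j : ℝ) ≤ ‖p.1 t‖} →
      (∀ ω', bondInterfaceIn D (E (δs k)) ω' = CurveClass.mk
        ⟨polyline ((medialExploration (E (δs k)) ω').map (medialPoint (E (δs k)).δ))⟩) ∧
      IsLoewnerDescribable (φs k) (bondInterfaceIn D (E (δs k)) ω) ∧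
      (∃ W₀ : C(ℝ≥0, ℝ), W₀ ∈ Process.modulusSet ({0} : Set ℝ) δW ∧
        drivingFunction (φs k) (bondInterfaceIn D (E (δs k)) ω) = W₀) ∧
      clock D (E (δs k)) (φs k) L 0 ω ≤ Δ ∧
      ∀ n, n < (finite_innerCorners (hδadm k)).toFinset.card →
        clock D (E (δs k)) (φs k) L (n + 1) ω ≤ clock D (E (δs k)) (φs k) L n ω + Δ := by
  set 𝒦 : Set (C(ℝ≥0, ℂ) × C(ℝ≥0, ℝ)) := {p | p ∈ generatedPairs ∧
    p.1 ∈ Process.modulusSet ({0} : Set ℂ) δγ ∧ p.2 ∈ Process.modulusSet ({0} : Set ℝ) δW ∧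
    ∀ (j : ℕ) (t : ℝ≥0), Tt j ≤ t → (j : ℝ) ≤ ‖p.1 t‖} with h𝒦def
  have h𝒦 : IsCompact 𝒦 := isCompact_pairBox hδγ hδW Tt
  have hgen : 𝒦 ⊆ generatedPairs := fun p hp ↦ hp.1
  have htr : ∀ p ∈ 𝒦, Tendsto (fun u ↦ ‖p.1 u‖) atTop atTop := fun p hp ↦
    tendsto_atTop_atTop.2 fun b ↦ ⟨Tt ⌈b⌉₊, fun u hu ↦ (Nat.le_ceil b).trans (hp.2.2.2 _ u hu)⟩
  obtain ⟨R, hR⟩ := exists_forall_norm_apply_le_of_isCompact h𝒦 (L + Δ)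
  obtain ⟨ρ, hρ, hNS⟩ := exists_nonstall h𝒦 hgen L hΔ
  obtain ⟨m, hm, hAI⟩ := exists_almostInj (Φs := fun k ↦ (φs k).boundaryExtension) (hU1 R) hρ
  obtain ⟨ρ₁, hρ₁, hproper⟩ := exists_forall_le_dist_boundaryExtension_of_varying hφ hφs hU1 hb R
  have hmesh : ∀ᶠ k in atTop, δs k < min (m / 4) (ρ₁ / 2) :=
    hδ0.eventually (gt_mem_nhds (lt_min (by positivity) (by positivity)))
  filter_upwards [hor, hAI, hmesh] with k hork hAIk hmeshk ω hω
  have hork' : ∀ ω, bondInterfaceIn D (E (δs k)) ω = CurveClass.mk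
      ⟨polyline ((medialExploration (E (δs k)) ω).map (medialPoint (E (δs k)).δ))⟩ := hork
  have hδk : (E (δs k)).δ = δs k := hEf.δ_eq (δs k)
  have hδk0 : 0 ≤ (E (δs k)).δ := by rw [hδk]; exact (hδpos k).le
  have hδm : 4 * (E (δs k)).δ < m := by
    rw [hδk]; linarith [hmeshk.trans_le (min_le_left _ _)]
  have hδρ : 2 * (E (δs k)).δ < ρ₁ := by
    rw [hδk]; linarith [hmeshk.trans_le (min_le_right _ _)]
  obtain ⟨p, hp, hpω⟩ := hω
  have hdω : IsLoewnerDescribable (φs k) (bondInterfaceIn D (E (δs k)) ω) := by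
    rw [← hpω]
    exact (isLoewnerDescribed_compactifiedClass (hφs k) hp.1 (htr p hp)).isLoewnerDescribable
  have hdrv : drivingFunction (φs k) (bondInterfaceIn D (E (δs k)) ω) = p.2 := by
    rw [← hpω, drivingFunction_compactifiedClass (hφs k) hp.1 (htr p hp)]
  have htrace : Loewner.trace (drivingFunction (φs k) (bondInterfaceIn D (E (δs k)) ω)) = p.1 := by
    rw [hdrv]
    exact Loewner.IsGeneratedByCurve.trace_eq_holds p.2.continuous hp.1
  have hexp := isMedialExploration_of hork' (hφs k) hdω
  refine ⟨hork', hdω, ⟨p.2, hp.2.2.1, hdrv⟩, ?_, ?_⟩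
  · -- small start
    obtain ⟨s, hs, s', hs', -, -, hfar⟩ := hNS p hp 0 zero_le
    obtain ⟨T₀, hT₀, hT₀r⟩ := exists_capTime_zero (hφs k) (described_of hork' hdω) hexp hδk0
      (R := R) (ρ := ρ) (m := m) (ρ₁ := ρ₁) (Δ := Δ)
      (fun u hu ↦ by rw [htrace]; exact hR p hp u (hu.trans le_add_self))
      ⟨s, by simpa using hs, s', by simpa using hs', by rw [htrace]; exact hfar⟩
      hAIk (hproper k) hδm hδρ
    calc clock D (E (δs k)) (φs k) L 0 ω = min T₀ L := clock_eq_min hork' (hδadm k) (hφs k) L hdω hT₀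
      _ ≤ T₀ := min_le_left _ _
      _ ≤ Δ := hT₀r
  · -- increments
    intro n _
    have hθle : clock D (E (δs k)) (φs k) L (n + 1) ω ≤ L := clock_le L (n + 1) ω
    by_cases hex : ∃ T : ℝ≥0, (φs k).boundaryExtension ''
        (Loewner.trace (drivingFunction (φs k) (bondInterfaceIn D (E (δs k)) ω)) '' Icc 0 T) =
        range (polyline ((explorationPrefix (E (δs k)) n ω).map (medialPoint (E (δs k)).δ)))
    · obtain ⟨Tn, hTn⟩ := hex
      have hθn : clock D (E (δs k)) (φs k) L n ω = min Tn L :=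
        clock_eq_min hork' (hδadm k) (hφs k) L hdω hTn
      rcases le_or_gt L Tn with hLT | hTL
      · rw [hθn, min_eq_right hLT]
        exact hθle.trans le_self_add
      · obtain ⟨T', hT', hT'le⟩ := exists_capTime_succ (hφs k) (described_of hork' hdω) hexp hδk0
          (R := R) (ρ := ρ) (m := m) (ρ₁ := ρ₁) (L := L) (Δ := Δ)
          (fun u hu ↦ by rw [htrace]; exact hR p hp u hu)
          (fun T hT ↦ by rw [htrace]; exact hNS p hp T hT)
          hAIk (hproper k) hδm hδρ hTL.le hTn
        calc clock D (E (δs k)) (φs k) L (n + 1) ω = min T' L :=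
              clock_eq_min hork' (hδadm k) (hφs k) L hdω hT'
          _ ≤ T' := min_le_left _ _
          _ ≤ Tn + Δ := hT'le
          _ = clock D (E (δs k)) (φs k) L n ω + Δ := by rw [hθn, min_eq_left hTL.le]
    · have hθn : clock D (E (δs k)) (φs k) L n ω = L :=
        clock_eq_cap hork' (hδadm k) (hφs k) L hdω hex
      rw [hθn]
      exact hθle.trans le_self_add

/-! ### The level step: a bounded class stopping step -/

/-- **The first step at which a predicate holds, capped at `N`.**  For every family of
predicates `S n` there is `ν ≤ N` with: `S (ν ω) ω` or `ν ω = N`; no `n < ν ω` has `S n ω`;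
and `{ν ≤ j}` is "`∃ n ≤ j, S n ω` or `N ≤ j`" — so that `ν` is a class stopping step as soon
as each `S n` is a class predicate of the prefix of depth `n`. [folklore] -/
theorem exists_levelStep {Ω₁ : Type*} (S : ℕ → Ω₁ → Prop) (N : ℕ) :
    ∃ ν : Ω₁ → ℕ, (∀ ω, ν ω ≤ N) ∧ (∀ ω, S (ν ω) ω ∨ N ≤ ν ω) ∧
      (∀ ω n, n < ν ω → ¬ S n ω) ∧
      ∀ ω j, ν ω ≤ j ↔ (∃ n ≤ j, S n ω) ∨ N ≤ j := by
  classical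
  have hex : ∀ ω, ∃ n, S n ω ∨ N ≤ n := fun ω ↦ ⟨N, Or.inr le_rfl⟩
  refine ⟨fun ω ↦ Nat.find (hex ω), fun ω ↦ Nat.find_min' (hex ω) (Or.inr le_rfl),
    fun ω ↦ Nat.find_spec (hex ω), fun ω n hn h ↦ Nat.find_min (hex ω) hn (Or.inl h), fun ω j ↦ ?_⟩
  rw [Nat.find_le_iff]
  constructor
  · rintro ⟨n, hn, h | h⟩
    · exact Or.inl ⟨n, hn, h⟩
    · exact Or.inr (h.trans hn)
  · rintro (⟨n, hn, h⟩ | h)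
    · exact ⟨n, hn, Or.inl h⟩
    · exact ⟨j, le_rfl, Or.inr h⟩

/-- **A capped first step of class predicates is a class stopping step**: if for `n ≤ j` the
predicate `S n` takes the same value at `ω` and `ω₀`, then `ν ω ≤ j ↔ ν ω₀ ≤ j`. [folklore] -/
theorem levelStep_class {Ω₁ : Type*} {S : ℕ → Ω₁ → Prop} {N : ℕ} {ν : Ω₁ → ℕ}
    (hν : ∀ ω j, ν ω ≤ j ↔ (∃ n ≤ j, S n ω) ∨ N ≤ j) {ω ω₀ : Ω₁} {j : ℕ}
    (h : ∀ n, n ≤ j → (S n ω ↔ S n ω₀)) : ν ω ≤ j ↔ ν ω₀ ≤ j := by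
  rw [hν, hν]
  exact or_congr_left (exists_congr fun n ↦ and_congr_right fun hn ↦ h n hn)

/-! ### The frozen conditional crossing probability -/

/-- **The conditional crossing probability frozen at a bounded class stopping step.**  For
admissible data, site sets `X₁, X₂` and a bounded class stopping step `ν` of the exploration,
the variable `X = percSlitExpectation hD ½ ν 1_Q`, `Q = freeCrossing X₁ X₂`, is strongly
measurable with `|X| ≤ 1`, and its slit expectation at depth `n` at `ω₀` is the
`P_{1/2}`-probability of the slit crossing event of the prefix of depth `n ∧ ν(ω₀)` whenever
the left bank of that prefix has met the arc `A` only inside `X₂`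
(`Freezing.percSlitExpectation_frozen`, `EventIdentity.percSlitExpectation_indicator_freeCrossing`).
[cite: CamiaNewman2007, §5] [cite: DuminilCopinSmirnov2012Clay, §6.2, Lemma 6.6] -/
theorem exists_frozenCrossing {E₀ : DiscreteDobrushin} (hD : E₀.IsZdAdmissible)
    (X₁ X₂ : Set (Site 2)) {ν : BondConfig (Site 2) → ℕ} {N : ℕ}
    (hν : ∀ m (ω₀ ω : BondConfig (Site 2)), ω ∈ explorationCylinder hD ω₀ m → (ν ω ≤ m ↔ ν ω₀ ≤ m))
    (hνN : ∀ ω, ν ω ≤ N) :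
    ∃ X : BondConfig (Site 2) → ℝ, StronglyMeasurable X ∧ (∀ ω, |X ω| ≤ 1) ∧
      ∀ (n : ℕ) (ω₀ : BondConfig (Site 2)),
        EventIdentity.leftBank hD ω₀ (min n (ν ω₀)) ∩ E₀.zdArcA ⊆ X₂ →
        percSlitExpectation hD half n X ω₀ =
          (bondPercolation (zdGraph 2) half).real
            (EventIdentity.slitCrossing hD X₁ X₂ ω₀ (min n (ν ω₀))) := by
  set g : BondConfig (Site 2) → ℝ := (EventIdentity.freeCrossing E₀ X₁ X₂).indicator fun _ ↦ (1 : ℝ)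
    with hg
  have hgm : StronglyMeasurable g :=
    (stronglyMeasurable_const (b := (1 : ℝ))).indicator (EventIdentity.measurableSet_freeCrossing hD X₁ X₂)
  have hgK : ∀ ω, ‖g ω‖ ≤ 1 := fun ω ↦ by
    by_cases hω : ω ∈ EventIdentity.freeCrossing E₀ X₁ X₂
    · rw [hg, indicator_of_mem hω, norm_one]
    · rw [hg, indicator_of_notMem hω, norm_zero]; exact zero_le_one
  set X : BondConfig (Site 2) → ℝ := fun ω ↦ percSlitExpectation hD half (ν ω) g ω with hX
  set M : ℕ → BondConfig (Site 2) → ℝ := fun m ↦ percSlitExpectation hD half m g with hM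
  have hMart : Martingale M (explorationFiltration hD) (bondPercolation (zdGraph 2) half) :=
    martingale_percSlitExpectation hD half hgm hgK
  set τ : BondConfig (Site 2) → WithTop ℕ := fun ω ↦ (ν ω : WithTop ℕ) with hτ_def
  have hτ : IsStoppingTime (explorationFiltration hD) τ :=
    isStoppingTime_explorationFiltration_of_forall_mem fun m ω₁ ω hω ↦ by
      simp only [hτ_def]
      exact_mod_cast hν m ω₁ ω hω
  have hSVτ : stoppedValue M τ = X := by
    funext ω
    simp only [stoppedValue, hτ_def, hX]
    rfl
  have hXm : StronglyMeasurable X := by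
    rw [← hSVτ]
    exact ((measurable_stoppedValue hMart.stronglyAdapted.isStronglyProgressive_of_discrete hτ).mono
      hτ.measurableSpace_le le_rfl).stronglyMeasurable
  refine ⟨X, hXm, fun ω ↦ ?_, fun n ω₀ hA ↦ ?_⟩
  · have := norm_percSlitExpectation_le (hD := hD) half hgK (ν ω) ω
    rwa [Real.norm_eq_abs] at this
  · rw [hX, Freezing.percSlitExpectation_frozen hgm hgK ν hν hνN n ω₀]
    exact EventIdentity.percSlitExpectation_indicator_freeCrossing half hA

end SlitCardyCut

/-- **Anchor of this file** (cut-1 of STUB A3b, clock side): the conditional crossing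
probability frozen at a bounded class stopping step, fully explicit form of
`SlitCardyCut.exists_frozenCrossing`. [cite: CamiaNewman2007, §5] -/
theorem slitCardyCut_exists_frozenCrossing : ∀ {E₀ : Literature.Probability.LatticeModels.DiscreteDobrushin} (hD : E₀.IsZdAdmissible) (X₁ X₂ : Set (Literature.Probability.LatticeModels.Site 2)) {ν : Literature.Probability.Percolation.BondConfig (Literature.Probability.LatticeModels.Site 2) → ℕ} {N : ℕ}, (∀ (m : ℕ) (ω₀ ω : Literature.Probability.Percolation.BondConfig (Literature.Probability.LatticeModels.Site 2)), ω ∈ Literature.Probability.LatticeModels.DiscreteDobrushin.explorationCylinder hD ω₀ m → (ν ω ≤ m ↔ ν ω₀ ≤ m)) → (∀ ω, ν ω ≤ N) → ∃ X : Literature.Probability.Percolation.BondConfig (Literature.Probability.LatticeModels.Site 2) → ℝ, MeasureTheory.StronglyMeasurable X ∧ (∀ ω, |X ω| ≤ 1) ∧ ∀ (n : ℕ) (ω₀ : Literature.Probability.Percolation.BondConfig (Literature.Probability.LatticeModels.Site 2)), EventIdentity.leftBank hD ω₀ (min n (ν ω₀)) ∩ E₀.zdArcA ⊆ X₂ → Summit.CriticalPhenomena.CardyFormulaZ2.Cruxes.ParafermionToSLESixFamilies.CaratheodoryNetSlitUniformity.percSlitExpectation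 hD Literature.Probability.Percolation.half n X ω₀ = (Literature.Probability.Percolation.bondPercolation (Literature.Probability.LatticeModels.zdGraph 2) Literature.Probability.Percolation.half).real (EventIdentity.slitCrossing hD X₁ X₂ ω₀ (min n (ν ω₀))) :=
  fun hD X₁ X₂ _ _ hν hνN ↦ SlitCardyCut.exists_frozenCrossing hD X₁ X₂ hν hνN

end Summit.CriticalPhenomena.CardyFormulaZ2.Cruxes.CardyRigidity.CrossingMartingale

end
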